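import Summits.Schanuel.Schanuel.Theses.RootDecomp1K
import Summits.Schanuel.Schanuel.Theses.DiophantineCore
import Summits.Schanuel.Schanuel.Theses.EclCore
import Summits.Schanuel.Schanuel.Theorems.RootDecomp1KHyper16
import Summits.Schanuel.Schanuel.Theorems.RootDecomp1KGeneric02
import Summits.Schanuel.Schanuel.Theorems.RootDecomp1EssentialInEclCore
import Literature.NumberTheory.Transcendental.DiazGrid
import Literature.NumberTheory.Transcendental.KirbyWeakSchanuelAx
import Literature.NumberTheory.Transcendental.SchanuelEclEmptyProofs
import Literature.NumberTheory.Transcendental.ZilberFieldQuasiminimal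
import Literature.NumberTheory.Transcendental.EclPregeometryProofs
import Literature.NumberTheory.Transcendental.EclClosureOperatorProofs

/-!
# RootDecomp1KB3KirbyTrace — lens 6, generation 25, node 2 «THE LIOUVILLE SIDE OF 1K LIVES ON KIRBY'S COUNTABLE CORE» (CLAIM L2330, PRICE + CHECKLIST G30-α L2334, NODE L2341, critic VERDICT L2344: CLEARED THEOREM ×1 = CONDITIONAL CORE-COLLAPSE CERTIFICATE, moves no item, rung 0; PORT GO L2346) — part 1 (RootDecomp1KB3KirbyTrace01): §1 the core E, §2 measures vs cut predicates, §3 the crux 3817 on the core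

(lens-6 g25b HOME kernel K2 = HOME/decomp-schanuel-lens-6/g25/B3KirbyTrace.lean 507fd15c…, 722 l, imports Theses RootDecomp1K / DiophantineCore / EclCore + Theorems RootDecomp1KHyper16 / RootDecomp1KGeneric02 / RootDecomp1EssentialInEclCore + six Literature Kirby/ecl/Diaz modules; P2/C2 + NODE-g25b.md 734c3ad1…. Port by census-1 gen 20 as `RootDecomp1KB3KirbyTrace01–03`: 01 = §1 the countable core `E = ecl ∅` (`span_le_E`), §2 measures vs the route's cut predicates (`measure_pow_of_poly`, `not_linLiouville_of_measure`, `not_hyperLinLiouville_of_measure`, `not_liouville_of_pair_measure`), §3 the crux 3817 on the core (`khovanskii_witness`, `measure_of_bakerOnE`, `not_linLiouville_of_bakerOnE`, `not_hyperLinLiouville_of_bakerOnE`, `not_liouville_coord_of_bakerOnE`, `not_coordLiouvilleSpan_of_bakerOnE`, price tag `not_liouville_exp_exp_one_of_bakerOnExpAlgebraic`); 02 = §4 the pointwise Kirby trace (`sb_of_eclTrace`, KNOWN Kirby 2010 Prop 7.2 / KNOWN-IN-TREE item 24395 `essentialCounterexamplesInEcl_core` BY NAME) + §5 the four items restricted to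 `E` (`…OnE`), `schanuel_of_piecesOnE`, heredity (`linLiouville_of_lattice`, `linLiouville_of_spanQ`, `polyMeasure_hered`, `coordClause_hered`) and the ONE iff `polyDiophantineSchanuelOnE_iff : B₃ᴱ ↔ B₃`; 03 = §6 (†) `schanuel_of_bakerOnExpAlgebraic_of_polyDiophantineSchanuel : BakerOnExpAlgebraic → PolyDiophantineSchanuel → Schanuel`, `aPiecesOnE_of_bakerOnExpAlgebraic`, §7 (†′) `schanuel_of_thOnExpAlgebraic_of_piecesOnE`, `bakerOnExpAlgebraicImpTH_holds : BakerOnExpAlgebraicImpTH` (item stmt-Schanuel-3818 of route DiophantineCore, PROVED), §8 T5 `polyDiophantineSchanuel_of_schanuelUnderTH : SchanuelUnderTH → PolyDiophantineSchanuel`.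
PORT EDITS (census g20): the §1 membership one-liners (`zero/one/add/sub/mul/div/exp/ratCast/natCast/two_mem_E`, `I_mem_E`, `conj_mem_E`, `re_mem_E`, `im_mem_E`, `exp_exp_one_mem_E`, `mem_eclSubfield_iff`), `linearIndependent_one_of_irrational` and the read-back `schanuel_iff_eclcoreThesis` are `private` (dedup-safety: tree twins `AclSubsetLogFreeCore/Negative/CoreAut*` `sub_mem_ecl_empty` / `I_mem_ecl_empty` / `conj_mem_ecl_empty` / `ofReal_re_mem_ecl_empty` / `ofReal_im_mem_ecl_empty` / `ratCast_mem_ecl_empty` / `cexp_mem_ecl_empty`, `RootDecomp1PillayTupleExpE.expE_mem_ecl`, `RootDecomp1BRadicalDescent.linearIndependent_one_of_irrational`); K's two auxiliary data definitions `conjExpHom` (+ `conjExpHom_apply`) and `eclSubmoduleQ` are INLINED into the proofs of `conj_mem_E` / `span_le_E` (no `def` outside §5); the unused `intCast_mem_E` is dropped; the four `…OnE` restricted-item definitions carry the «[restriction] definition» docstring tag; all other statements and proofs verbatim. Parts 01/02 `--supports stmt-Schanuel-31987` (the residual), part 03 `--workitem stmt-Schanuel-3818` (it proves that support item of route DiophantineCore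 by name) if the gate accepts, else `--supports`; no census credit carried; rung 0 — nothing here proves Schanuel.)
-/

/-!
# Route `Schanuel/RootDecomp1K` — the Liouville side of the carving lives on Kirby's countable core

Lens-6 («barrier-complement carving»), generation 25, node 2.  The tree PROVES (Kirby 2010,
Thm 1.2 / Prop 7.2 over Ax 1971: `schanuelConjecture_iff_ecl_empty_holds`,
`kirby_relative_schanuel_complex_holds`) that Schanuel's conjecture is equivalent to its restriction to
`ℚ`-free tuples from the countable, conjugation-stable E-subfield `E = ecl ∅ ⊂ ℂ` of exponentially
algebraic numbers.  This file runs that reduction THROUGH the four live items of the route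
(`CoordLiouvilleSchanuel` 31077, `HyperLiouvilleSchanuel` 33363, `FiniteOrderLiouvilleSchanuel` 33364 and
the residual `PolyDiophantineSchanuel` 31987):

* §4 `sb_of_eclTrace` — a POINTWISE Kirby trace: Schanuel's inequality at a `ℚ`-free `x̄` follows from
  the inequality at the `ℚ`-free tuples of `E ∩ span_ℤ(x̄)`;
* §5 the four items restricted to `E`-tuples (`…OnE`) still decide the summit
  (`schanuel_of_piecesOnE`), and the residual is EXACTLY equivalent to its `E`-restriction
  (`polyDiophantineSchanuel_iff_onE`: both Diophantine hypotheses of B₃ descend to sub-lattice tuples);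
* §3/§6 on `E` the Diophantine crux `BakerOnExpAlgebraic` (stmt-Schanuel-3817, route DiophantineCore)
  makes the three Liouville-side items VACUOUS (`no E-number has a Liouville coordinate`,
  `no ℚ-free E-tuple is linearly Liouville`), whence the two-hypothesis deciding theorem
  `schanuel_of_bakerOnExpAlgebraic_of_polyDiophantineSchanuel : BakerOnExpAlgebraic →
  PolyDiophantineSchanuel → Schanuel` — the residual ALONE carries the summit modulo 3817, and the
  three A-items are needed only OFF the countable core `E`;
* a price tag of 3817 read off the same lemma: `BakerOnExpAlgebraic → ¬ Liouville (exp (exp 1))`.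

No `sorry`, no new axioms; Kirby/Ax enter only through the tree's `_holds` theorems, by name.
-/

noncomputable section

open Complex IntermediateField Finset
open scoped BigOperators

namespace Summit.Schanuel.Schanuel.Theorems.RootDecomp1KB3KirbyTrace

open Literature.NumberTheory.Transcendental
open Literature.ModelTheory.ExponentialFields (ExponentialRing ExponentialRingHom)
open Summit.Schanuel.Schanuel.Theses.RootDecomp1K (PolyDiophantineSchanuel CoordLiouvilleSchanuel
  HyperLiouvilleSchanuel FiniteOrderLiouvilleSchanuel LinLiouvilleSchanuel StrictDiophantineSchanuel)
open Summit.Schanuel.Schanuel.Theses.DiophantineCore (BakerOnExpAlgebraic THOnExpAlgebraic SchanuelUnderTH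
  BakerOnExpAlgebraicImpTH)
open Summit.Schanuel.Schanuel.Theses.EclCore (EclcoreThesis)
open Summit.Schanuel.Schanuel.Theorems.RootDecomp1EssentialInEclCore (essentialCounterexamplesInEcl_core)
open Summit.Schanuel.Schanuel.Theorems.RootDecomp1KGeneric (not_technicalHypothesis_of_hyperLinLiouville)
open Summit.Schanuel.Schanuel.Theorems.RootDecomp1KHyper (LinLiouville CoordLiouvilleSpan one_le_hsum
  hsum_nonneg exists_half_pow_le exists_le_two_pow linLiouville_of_liouville_ratio)
open Summit.Schanuel.Schanuel.Theorems.RootDecomp1KHyper.HyperCell (HyperLinLiouville)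

/-! ### §1  The countable core `E = ecl ∅`: field operations, `i`, conjugation, coordinates, spans

(PORT: the membership one-liners are file-local — `private` — because the tree already proves most
of them under other names (`AclSubsetLogFreeCore/Negative/CoreAut*`: `sub_mem_ecl_empty`,
`I_mem_ecl_empty`, `conj_mem_ecl_empty`, `ofReal_re_mem_ecl_empty`, `ofReal_im_mem_ecl_empty`,
`ratCast_mem_ecl_empty`, `cexp_mem_ecl_empty`; `RootDecomp1PillayTupleExpE.expE_mem_ecl`); the two
auxiliary data definitions of K (`conjExpHom`, `eclSubmoduleQ`) are inlined into the proofs of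
`conj_mem_E` / `span_le_E`, statements unchanged.) -/

/-- Membership in the subfield `Khovanskii.eclSubfield ∅` is membership in `E = ecl ∅`. -/
private theorem mem_eclSubfield_iff {a : ℂ} :
    a ∈ Khovanskii.eclSubfield (∅ : Set ℂ) ↔ a ∈ ecl (∅ : Set ℂ) := Iff.rfl

/-- `0 ∈ E`. -/
private theorem zero_mem_E : (0 : ℂ) ∈ ecl (∅ : Set ℂ) := Khovanskii.zero_mem_ecl _

/-- `1 ∈ E`. -/
private theorem one_mem_E : (1 : ℂ) ∈ ecl (∅ : Set ℂ) := Khovanskii.one_mem_ecl _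

/-- `E` is closed under addition. -/
private theorem add_mem_E {a b : ℂ} (ha : a ∈ ecl (∅ : Set ℂ)) (hb : b ∈ ecl (∅ : Set ℂ)) :
    a + b ∈ ecl (∅ : Set ℂ) := Khovanskii.add_mem_ecl ha hb

/-- `E` is closed under subtraction (tree twin: `sub_mem_ecl_empty`). -/
private theorem sub_mem_E {a b : ℂ} (ha : a ∈ ecl (∅ : Set ℂ)) (hb : b ∈ ecl (∅ : Set ℂ)) :
    a - b ∈ ecl (∅ : Set ℂ) := by
  rw [sub_eq_add_neg]; exact Khovanskii.add_mem_ecl ha (Khovanskii.neg_mem_ecl hb)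

/-- `E` is closed under multiplication. -/
private theorem mul_mem_E {a b : ℂ} (ha : a ∈ ecl (∅ : Set ℂ)) (hb : b ∈ ecl (∅ : Set ℂ)) :
    a * b ∈ ecl (∅ : Set ℂ) := Khovanskii.mul_mem_ecl ha hb

/-- `E` is closed under division. -/
private theorem div_mem_E {a b : ℂ} (ha : a ∈ ecl (∅ : Set ℂ)) (hb : b ∈ ecl (∅ : Set ℂ)) :
    a / b ∈ ecl (∅ : Set ℂ) := by
  rw [div_eq_mul_inv]; exact Khovanskii.mul_mem_ecl ha (Khovanskii.inv_mem_ecl hb)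

/-- `E` is closed under `exp` (tree twin: `cexp_mem_ecl_empty`). -/
private theorem exp_mem_E {a : ℂ} (ha : a ∈ ecl (∅ : Set ℂ)) : cexp a ∈ ecl (∅ : Set ℂ) :=
  Khovanskii.exp_mem_ecl ha

/-- Rationals lie in `E` (tree twin: `ratCast_mem_ecl_empty`). -/
private theorem ratCast_mem_E (q : ℚ) : (q : ℂ) ∈ ecl (∅ : Set ℂ) :=
  mem_eclSubfield_iff.mp (SubfieldClass.ratCast_mem (Khovanskii.eclSubfield (∅ : Set ℂ)) q)

/-- Naturals lie in `E`. -/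
private theorem natCast_mem_E (c : ℕ) : (c : ℂ) ∈ ecl (∅ : Set ℂ) :=
  mem_eclSubfield_iff.mp (natCast_mem (Khovanskii.eclSubfield (∅ : Set ℂ)) c)

/-- `2 ∈ E`. -/
private theorem two_mem_E : (2 : ℂ) ∈ ecl (∅ : Set ℂ) := by simpa using natCast_mem_E 2

/-- `i ∈ E`: a root of the integer polynomial `X² + 1` (tree twin: `I_mem_ecl_empty`). -/
private theorem I_mem_E : I ∈ ecl (∅ : Set ℂ) := by
  have hp0 : (Polynomial.X ^ 2 + 1 : Polynomial ℂ) ≠ 0 := by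
    intro h
    have h1 := congrArg (Polynomial.eval 0) h
    simp at h1
  refine Khovanskii.mem_ecl_of_isRoot hp0 (fun n => ?_) ?_
  · rw [Polynomial.coeff_add]
    refine add_mem_E ?_ ?_
    · rw [Polynomial.coeff_X_pow]; split_ifs; exacts [one_mem_E, zero_mem_E]
    · rw [Polynomial.coeff_one]; split_ifs; exacts [one_mem_E, zero_mem_E]
  · show Polynomial.eval I (Polynomial.X ^ 2 + 1) = 0
    simp [I_sq]

/-- `E` is stable under complex conjugation (functoriality of `ecl`, Kirby 2010 Def. 3.2, applied to
the E-ring endomorphism `conj` — `exp (conj z) = conj (exp z)`; tree twin: `conj_mem_ecl_empty`). -/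
private theorem conj_mem_E {w : ℂ} (hw : w ∈ ecl (∅ : Set ℂ)) : (starRingEnd ℂ) w ∈ ecl (∅ : Set ℂ) := by
  have h := Khovanskii.image_ecl_subset
    ({ starRingEnd ℂ with
       map_exp' := fun x => by
         show (starRingEnd ℂ) (cexp x) = cexp ((starRingEnd ℂ) x)
         exact (Complex.exp_conj x).symm } : ExponentialRingHom ℂ ℂ) (∅ : Set ℂ) ⟨w, hw, rfl⟩
  rw [Set.image_empty] at h
  exact h

/-- The real part of an `E`-number is an `E`-number (tree twin: `ofReal_re_mem_ecl_empty`). -/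
private theorem re_mem_E {w : ℂ} (hw : w ∈ ecl (∅ : Set ℂ)) : ((w.re : ℝ) : ℂ) ∈ ecl (∅ : Set ℂ) := by
  have h : ((w.re : ℝ) : ℂ) = (w + (starRingEnd ℂ) w) / 2 := by
    rw [Complex.add_conj]; push_cast; ring
  rw [h]
  exact div_mem_E (add_mem_E hw (conj_mem_E hw)) two_mem_E

/-- The imaginary part of an `E`-number is an `E`-number (tree twin: `ofReal_im_mem_ecl_empty`). -/
private theorem im_mem_E {w : ℂ} (hw : w ∈ ecl (∅ : Set ℂ)) : ((w.im : ℝ) : ℂ) ∈ ecl (∅ : Set ℂ) := by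
  have h : ((w.im : ℝ) : ℂ) = (w - (starRingEnd ℂ) w) / (2 * I) := by
    rw [Complex.sub_conj]; push_cast; field_simp
  rw [h]
  exact div_mem_E (sub_mem_E hw (conj_mem_E hw)) (mul_mem_E two_mem_E I_mem_E)

/-- The `ℚ`-span of an `E`-tuple lies in `E` (`E` is a `ℚ`-subspace of `ℂ`). -/
theorem span_le_E {n : ℕ} {x : Fin n → ℂ} (hx : ∀ i, x i ∈ ecl (∅ : Set ℂ)) {w : ℂ}
    (hw : w ∈ Submodule.span ℚ (Set.range x)) : w ∈ ecl (∅ : Set ℂ) := by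
  induction hw using Submodule.span_induction with
  | mem y hy =>
    obtain ⟨i, rfl⟩ := hy
    exact hx i
  | zero => exact zero_mem_E
  | add a b _ _ ha hb => exact add_mem_E ha hb
  | smul q a _ ha =>
    rw [Rat.smul_def]
    exact mul_mem_E (ratCast_mem_E q) ha

/-- `e^e ∈ E` (two applications of exp-closure to `1`; tree twin: `RootDecomp1PillayTupleExpE.expE_mem_ecl`). -/
private theorem exp_exp_one_mem_E : cexp (cexp 1) ∈ ecl (∅ : Set ℂ) := exp_mem_E (exp_mem_E one_mem_E)

/-! ### §2  Diophantine bookkeeping: measures versus the route's cut predicates -/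

/-- A polynomial linear-independence measure `c ≤ (Σ|hᵢ|)^κ ‖Σ hᵢxᵢ‖` (the conclusion of 3817) yields
the route's spelling `(1 + Σ|hᵢ|)^{−ω} ≤ ‖Σ hᵢxᵢ‖` for some `ω`. -/
theorem measure_pow_of_poly {n : ℕ} {x : Fin n → ℂ} {c : ℝ} (hc : 0 < c) {κ : ℕ}
    (hb : ∀ h : Fin n → ℤ, h ≠ 0 → c ≤ (∑ i, (|h i| : ℝ)) ^ κ * ‖∑ i, (h i : ℂ) * x i‖) :
    ∃ ω : ℕ, ∀ h : Fin n → ℤ, h ≠ 0 → 1 / (1 + ∑ i, (|h i| : ℝ)) ^ ω ≤ ‖∑ i, (h i : ℂ) * x i‖ := by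
  obtain ⟨t, ht⟩ := exists_half_pow_le hc
  refine ⟨κ + t, fun h hh => ?_⟩
  have hS1 : 1 ≤ ∑ i, (|h i| : ℝ) := one_le_hsum hh
  have hSpos : 0 < ∑ i, (|h i| : ℝ) := by linarith
  have hcb : c ≤ (∑ i, (|h i| : ℝ)) ^ κ * ‖∑ i, (h i : ℂ) * x i‖ := hb h hh
  have h1 : (∑ i, (|h i| : ℝ)) ^ κ * 2 ^ t ≤ (1 + ∑ i, (|h i| : ℝ)) ^ (κ + t) := by
    rw [pow_add]
    exact mul_le_mul (pow_le_pow_left₀ hSpos.le (by linarith) κ)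
      (pow_le_pow_left₀ (by norm_num) (by linarith) t) (by positivity) (by positivity)
  have h2 : 1 / (1 + ∑ i, (|h i| : ℝ)) ^ (κ + t) ≤ 1 / ((∑ i, (|h i| : ℝ)) ^ κ * 2 ^ t) :=
    one_div_le_one_div_of_le (by positivity) h1
  refine h2.trans ?_
  rw [div_le_iff₀ (by positivity)]
  have h3 : 1 ≤ c * 2 ^ t := by
    have h4 := ht
    rw [div_le_iff₀ (by positivity)] at h4
    linarith
  calc (1 : ℝ) ≤ c * 2 ^ t := h3
    _ ≤ (∑ i, (|h i| : ℝ)) ^ κ * ‖∑ i, (h i : ℂ) * x i‖ * 2 ^ t :=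
        mul_le_mul_of_nonneg_right hcb (by positivity)
    _ = ‖∑ i, (h i : ℂ) * x i‖ * ((∑ i, (|h i| : ℝ)) ^ κ * 2 ^ t) := by ring

/-- A measure of some order `ω` forbids `LinLiouville`. -/
theorem not_linLiouville_of_measure {n : ℕ} {x : Fin n → ℂ} {ω : ℕ}
    (hm : ∀ h : Fin n → ℤ, h ≠ 0 → 1 / (1 + ∑ i, (|h i| : ℝ)) ^ ω ≤ ‖∑ i, (h i : ℂ) * x i‖) :
    ¬ LinLiouville x := fun hL => by
  obtain ⟨h, hh, hlt⟩ := hL ω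
  exact absurd (hm h hh) (not_le.mpr hlt)

/-- … and a fortiori `HyperLinLiouville`. -/
theorem not_hyperLinLiouville_of_measure {n : ℕ} {x : Fin n → ℂ} {ω : ℕ}
    (hm : ∀ h : Fin n → ℤ, h ≠ 0 → 1 / (1 + ∑ i, (|h i| : ℝ)) ^ ω ≤ ‖∑ i, (h i : ℂ) * x i‖) :
    ¬ HyperLinLiouville x := fun hH => not_linLiouville_of_measure hm hH.linLiouville

/-- `(1, u)` is `ℚ`-free for `u` irrational. -/
private theorem linearIndependent_one_of_irrational {u : ℝ} (hu : Irrational u) :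
    LinearIndependent ℚ ![(1 : ℂ), (u : ℂ)] := by
  refine LinearIndependent.pair_iff.mpr fun s t hst => ?_
  have hst' : (s : ℂ) + (t : ℂ) * (u : ℂ) = 0 := by
    simpa [Rat.smul_def] using hst
  have hre : (s : ℝ) + (t : ℝ) * u = 0 := by
    have h := congrArg Complex.re hst'
    simpa using h
  by_cases ht : t = 0
  · subst ht
    have hs : (s : ℝ) = 0 := by simpa using hre
    exact ⟨by exact_mod_cast hs, rfl⟩
  · exfalso
    apply hu
    refine ⟨-s / t, ?_⟩
    have htR : (t : ℝ) ≠ 0 := by exact_mod_cast ht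
    push_cast
    field_simp
    linarith

/-- A measure on the pair `(1, u)`, `u` real, forbids `u` Liouville (Liouville approximations ARE
linear forms of every polynomial order of smallness: the tree's `linLiouville_of_liouville_ratio`). -/
theorem not_liouville_of_pair_measure {u : ℝ} {ω : ℕ}
    (hm : ∀ h : Fin 2 → ℤ, h ≠ 0 →
      1 / (1 + ∑ i, (|h i| : ℝ)) ^ ω ≤ ‖∑ i, (h i : ℂ) * (![(1 : ℂ), (u : ℂ)] : Fin 2 → ℂ) i‖) :
    ¬ Liouville u := fun hL =>
  not_linLiouville_of_measure hm (by simpa using linLiouville_of_liouville_ratio hL 1)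

/-! ### §3  The Diophantine crux 3817 on the core: Liouville phenomena are absent from `E` -/

/-- Khovanskii witness data for a point of `E`, in the inlined spelling shared by the items
3815/3817 of route `DiophantineCore` (integer coefficients as `∃ c : ℤ, ↑c = coeff`). -/
theorem khovanskii_witness {a : ℂ} (ha : a ∈ ecl (∅ : Set ℂ)) :
    ∃ (m : ℕ) (z : Fin m → ℂ) (f : Fin m → MvPolynomial (Fin m ⊕ Fin m) ℂ), (∃ k, z k = a) ∧
      (∀ k mo, ∃ c : ℤ, (c : ℂ) = (f k).coeff mo) ∧
      (∀ k, MvPolynomial.eval (Sum.elim z (Complex.exp ∘ z)) (f k) = 0) ∧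
      (Matrix.of fun k j => MvPolynomial.eval (Sum.elim z (Complex.exp ∘ z))
        (MvPolynomial.pderiv (Sum.inl j) (f k) +
          MvPolynomial.X (Sum.inr j) * MvPolynomial.pderiv (Sum.inr j) (f k))).det ≠ 0 := by
  obtain ⟨m, z, f, hzi, hcoeff, heval, hdet⟩ := ha
  exact ⟨m, z, f, hzi,
    fun k mo => Subring.mem_bot.mp (by simpa only [Subring.closure_empty] using hcoeff k mo),
    heval, hdet⟩

/-- 3817 on a `ℚ`-free `E`-tuple, in the route's spelling of a measure. -/
theorem measure_of_bakerOnE (hA : BakerOnExpAlgebraic) {n : ℕ} {x : Fin n → ℂ}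
    (hx : ∀ i, x i ∈ ecl (∅ : Set ℂ)) (hli : LinearIndependent ℚ x) :
    ∃ ω : ℕ, ∀ h : Fin n → ℤ, h ≠ 0 → 1 / (1 + ∑ i, (|h i| : ℝ)) ^ ω ≤ ‖∑ i, (h i : ℂ) * x i‖ := by
  obtain ⟨c, hc, κ, hb⟩ := hA n x (fun i => khovanskii_witness (hx i)) hli
  exact measure_pow_of_poly hc hb

/-- Under 3817 no `ℚ`-free `E`-tuple is linearly Liouville … -/
theorem not_linLiouville_of_bakerOnE (hA : BakerOnExpAlgebraic) {n : ℕ} {x : Fin n → ℂ}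
    (hx : ∀ i, x i ∈ ecl (∅ : Set ℂ)) (hli : LinearIndependent ℚ x) : ¬ LinLiouville x := by
  obtain ⟨ω, hm⟩ := measure_of_bakerOnE hA hx hli
  exact not_linLiouville_of_measure hm

/-- … nor hyper-Liouville … -/
theorem not_hyperLinLiouville_of_bakerOnE (hA : BakerOnExpAlgebraic) {n : ℕ} {x : Fin n → ℂ}
    (hx : ∀ i, x i ∈ ecl (∅ : Set ℂ)) (hli : LinearIndependent ℚ x) : ¬ HyperLinLiouville x := by
  obtain ⟨ω, hm⟩ := measure_of_bakerOnE hA hx hli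
  exact not_hyperLinLiouville_of_measure hm

/-- … and NO `E`-NUMBER HAS A LIOUVILLE COORDINATE (apply 3817 to the `ℚ`-free `E`-pair `(1, Re w)`,
resp. `(1, Im w)`). -/
theorem not_liouville_coord_of_bakerOnE (hA : BakerOnExpAlgebraic) {w : ℂ} (hw : w ∈ ecl (∅ : Set ℂ)) :
    ¬ Liouville w.re ∧ ¬ Liouville w.im := by
  have key : ∀ u : ℝ, (u : ℂ) ∈ ecl (∅ : Set ℂ) → ¬ Liouville u := by
    intro u huE huL
    have hy : ∀ i, (![(1 : ℂ), (u : ℂ)] : Fin 2 → ℂ) i ∈ ecl (∅ : Set ℂ) := by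
      intro i
      fin_cases i
      · exact one_mem_E
      · exact huE
    obtain ⟨ω, hm⟩ := measure_of_bakerOnE hA hy (linearIndependent_one_of_irrational huL.irrational)
    exact not_liouville_of_pair_measure hm huL
  exact ⟨key w.re (re_mem_E hw), key w.im (im_mem_E hw)⟩

/-- … in particular the `ℚ`-span of an `E`-tuple carries no Liouville coordinate. -/
theorem not_coordLiouvilleSpan_of_bakerOnE (hA : BakerOnExpAlgebraic) {n : ℕ} {x : Fin n → ℂ}
    (hx : ∀ i, x i ∈ ecl (∅ : Set ℂ)) : ¬ CoordLiouvilleSpan x := by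
  rintro ⟨w, hw, hLw⟩
  have hwE : w ∈ ecl (∅ : Set ℂ) := span_le_E hx hw
  rcases hLw with h | h
  · exact (not_liouville_coord_of_bakerOnE hA hwE).1 h
  · exact (not_liouville_coord_of_bakerOnE hA hwE).2 h

/-- PRICE TAG of 3817 read off the core: `BakerOnExpAlgebraic` implies that `e^e` is not a Liouville
number (nothing is known unconditionally about the arithmetic nature of `e^e`). -/
theorem not_liouville_exp_exp_one_of_bakerOnExpAlgebraic (hA : BakerOnExpAlgebraic) :
    ¬ Liouville (Real.exp (Real.exp 1)) := by
  have h := (not_liouville_coord_of_bakerOnE hA exp_exp_one_mem_E).1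
  have hre : (cexp (cexp 1)).re = Real.exp (Real.exp 1) := by
    rw [show (1 : ℂ) = ((1 : ℝ) : ℂ) from rfl, ← Complex.ofReal_exp, ← Complex.ofReal_exp,
      Complex.ofReal_re]
  rwa [hre] at h

end Summit.Schanuel.Schanuel.Theorems.RootDecomp1KB3KirbyTrace

end
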